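import Summits.QuantumFields.YangMills.Theorems.SlackWindowPlancherelPointToBand
import Summits.QuantumFields.YangMills.Theorems.SlackWindowPlancherelCoveringLemmas
import Summits.QuantumFields.YangMills.Theorems.SquareRootCeilingsMirrorDominationRPCS
import HarnessLib

/-!
# Route `SlackWindow`, crux `CarrierSlackLargeMirrorCeiling` (stmt-QuantumFields-23686), LINE 1 «PlancherelCovering»
# (planner ym-idea-11 g12): the registered stub `stub_plancherelCovering` BY NAME AND SIGNATURE (WORK FILE)
-/

set_option autoImplicit false

namespace Summit.QuantumFields.YangMills.Theorems.SlackWindowPlancherelCovering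

open scoped BigOperators Topology Classical MeasureTheory
open Filter Set Function TopologicalSpace MeasureTheory

/-- STUB A (crux, the line's only open physics; n = 2 SIZE wall in smeared, positive currency, with
transverse wave packets).  Under SlackWindow's floors premise, selector and carrier clause VERBATIM
(s = carrier unit of OnsetCalibration: both torus floors at s, none on [2s,1]), for every transverse
profile `b` (Schwartz on ℝ³, compact support in the closed unit ball) there are `E ≥ 0`, `ℓ₄ > 0`, `β₄` such that for β ≥ β₄ there is `L₀` with: for every sub-carrier packet size `M`
(`1 ≤ M`, `M·s ≤ ℓ₄`), height `t₀ ∈ [M, 2M]`, orientation `q`, odd torus `2L+1` (`4M+8 ≤ L`, `L₀ ≤ L`)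
and every torus momentum `n ∈ box₃ L`, the WAVE-PACKET RP SQUARE
`S = M² Σ_{x,x' ∈ box₃ L} b(x/M) b(x'/M) cos(2π n·(x−x')/(2L+1)) Cov_L(P_q(t₀,x), P_q(−t₀−δ_q,x'))`
(the cos-packet square plus the sin-packet square; hyperscaling-normalised, O(1) at tree level ~ g⁴)
is at most `E / Π_j (1 + M|n_j|/(2L+1))²` (a summable product weight; the truth is `exp(−c·M|p̂_n|)`).  For |n| ≲ L/M this is plain boundedness of a smeared RP square
(cf. 23813); for |n| ≫ L/M it asks power-law TRANSVERSE SMOOTHNESS of the reflected two-point function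
at time separation ≥ 2M on the scale M — the ε-level, sub-carrier shadow of the spectral cone, in
positive currency.  Why it might fail: it is the n = 2 size wall (no β-uniform tool between lattice and
carrier scales) plus soft-rough spectral weight (low energy, lattice-scale transverse momentum) of size
≫ E·Π_j(1+M|p̂_j|)^{-2}; none expected (free field: exponentially small in M p̂). -/
def CarrierWavePacketBound : Prop :=
  open Literature.MathematicalPhysics.QuantumFieldTheory Literature.MathematicalPhysics.QuantumLattice Summit.QuantumFields.YangMills.Cruxes.OSLegsFromFemtoAndGap.DlrCollarTransfer in ∀ (G : Type) [Group G] [TopologicalSpace G] [IsTopologicalGroup G] [CompactSpace G], IsCompactSimpleLieGroup G → Nonempty (G ≃ₜ* Matrix.specialUnitaryGroup (Fin 2) ℂ) → letI : MeasurableSpace G := borel G; haveI : BorelSpace G := ⟨rfl⟩; ∀ (r : LatticeRep G) (v f g h : SchwartzMap (EuclideanSpace ℝ (Fin 4)) ℝ) (Λ₅ : ℝ), ∃ ε₀ : ℝ, 0 < ε₀ ∧ ∀ ε : ℝ, 0 < ε → ε ≤ ε₀ → (∃ β₅ : ℝ, ∀ β : ℝ, β₅ ≤ β → ∃ s : ℝ,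 0 < s ∧ s ≤ 1 ∧ (∀ L : ℕ, Λ₅ ≤ s * L → ε ≤ Q2 G r β L s (thetaTest 4 v) v) ∧ (∀ L : ℕ, Λ₅ ≤ s * L → ε ≤ |Q3 G r β L s f g h|)) → ∀ (b : SchwartzMap (EuclideanSpace ℝ (Fin 3)) ℝ), HasCompactSupport b → tsupport b ⊆ Metric.closedBall 0 1 → ∃ (E ℓ₄ β₄ : ℝ), 0 ≤ E ∧ 0 < ℓ₄ ∧ ∀ β : ℝ, β₄ ≤ β → ∃ L₀ : ℕ, ∀ s : ℝ, 0 < s → s ≤ 1 → (∀ s' : ℝ, 2 * s ≤ s' → s' ≤ 1 → ¬ ((∀ L : ℕ, Λ₅ ≤ s' * L → ε ≤ Q2 G r β L s' (thetaTest 4 v) v) ∧ (∀ L : ℕ, Λ₅ ≤ s' * L → ε ≤ |Q3 G r β L s' f g h|))) → ((∀ L : ℕ, Λ₅ ≤ s * L → ε ≤ Q2 G r β L s (thetaTest 4 v) v) ∧ (∀ L : ℕ, Λ₅ ≤ s * L → ε ≤ |Q3 G r β L s f g h|)) → ∀ (L : ℕ) (q : Fin 4 × Fin 4) (M t₀ :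 ℕ) (n : Fin 3 → ℤ), q.1 < q.2 → 1 ≤ M → (M : ℝ) * s ≤ ℓ₄ → M ≤ t₀ → t₀ ≤ 2 * M → 4 * M + 8 ≤ L → L₀ ≤ L → (∀ j, |n j| ≤ (L : ℤ)) → let δ : ℤ := if q.1 = 0 then 1 else 0 ; let cov : (Fin 3 → ℤ) → (Fin 3 → ℤ) → ℝ := fun x x' => torusE G r β L (fun U => (plane G r q (Fin.cons (t₀ : ℤ) x) U - torusE G r β L (plane G r q (Fin.cons (t₀ : ℤ) x))) * (plane G r q (Fin.cons (-(t₀ : ℤ) - δ) x') U - torusE G r β L (plane G r q (Fin.cons (-(t₀ : ℤ) - δ) x')))) ; let wt : (Fin 3 → ℤ) → ℝ := fun x => b (WithLp.toLp 2 fun j => (x j : ℝ) / (M : ℝ)) ; let phase : (Fin 3 → ℤ) → ℝ := fun z => 2 * Real.pi * (∑ j, (n j : ℝ) * (z j : ℝ)) / (2 * (L : ℝ) + 1) ; (M : ℝ) ^ 2 * ∑ x ∈ Fintype.piFinset (fun _ : Fin 3 => Finset.Icc (-(L : ℤ)) (L : ℤ)), ∑ x' ∈ Fintype.piFinset (fun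 _ : Fin 3 => Finset.Icc (-(L : ℤ)) (L : ℤ)), wt x * wt x' * Real.cos (phase (x - x')) * cov x x' ≤ E / ∏ j, (1 + (M : ℝ) * |(n j : ℝ)| / (2 * (L : ℝ) + 1)) ^ 2


namespace __Registered

/-- registered stub «PlancherelCovering» (support, M): `CarrierWavePacketBound → CarrierPointCeiling` (verbatim the skeleton's
`__Registered.stub_plancherelCovering`). -/
abbrev stub_plancherelCovering : Prop := CarrierWavePacketBound → CarrierPointCeiling

end __Registered

open Literature.MathematicalPhysics.QuantumFieldTheory Literature.MathematicalPhysics.QuantumLattice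
open Summit.QuantumFields.YangMills.Cruxes.OSLegsFromFemtoAndGap.DlrCollarTransfer
open Finset

/-- **The Plancherel covering inequality** (pure finite bookkeeping).  On the box `box₃ L = [-L, L]³` of the odd
torus `ℤ³_{2L+1}`, suppose a two-point kernel `cov` has constant diagonal `c` and, for every torus momentum
`n ∈ box₃ L`, the wave-packet square `R² Σ_{x,x'} b(x/R) b(x'/R) cos(2π n·(x−x')/(2L+1)) cov x x'` is at most
`E / Π_j (1 + R|n_j|/(2L+1))²`.  Summing over `n` (Plancherel: `Σ_n cos(2π n·z/(2L+1)) = (2L+1)³·[z ≡ 0]`,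
so only the diagonal survives) and using `Σ_x b(x/R)² ≥ (R/4)³` (from `b = 1` on the half ball) and
`Σ_n Π_j (1 + R|n_j|/(2L+1))^{-2} ≤ (1 + 2(2L+1)/R)³ ≤ (3(2L+1)/R)³` gives `c ≤ 1728·E/R⁸`. [folklore] -/
theorem point_le_of_wavePacket_bound (L R : ℕ) (hR : 1 ≤ R) (hRL : R ≤ L)
    (b : EuclideanSpace ℝ (Fin 3) → ℝ) (hb1 : ∀ u : EuclideanSpace ℝ (Fin 3), ‖u‖ ≤ 1 / 2 → b u = 1)
    (cov : (Fin 3 → ℤ) → (Fin 3 → ℤ) → ℝ) (c E : ℝ) (hE : 0 ≤ E)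
    (hdiag : ∀ x ∈ Fintype.piFinset (fun _ : Fin 3 => Icc (-(L : ℤ)) (L : ℤ)), cov x x = c)
    (hS : ∀ n ∈ Fintype.piFinset (fun _ : Fin 3 => Icc (-(L : ℤ)) (L : ℤ)),
      (R : ℝ) ^ 2 * ∑ x ∈ Fintype.piFinset (fun _ : Fin 3 => Icc (-(L : ℤ)) (L : ℤ)),
        ∑ x' ∈ Fintype.piFinset (fun _ : Fin 3 => Icc (-(L : ℤ)) (L : ℤ)),
          b (WithLp.toLp 2 fun j => (x j : ℝ) / (R : ℝ)) * b (WithLp.toLp 2 fun j => (x' j : ℝ) / (R : ℝ)) *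
            Real.cos (2 * Real.pi * (∑ j, (n j : ℝ) * ((x - x') j : ℝ)) / (2 * (L : ℝ) + 1)) * cov x x' ≤
        E / ∏ j, (1 + (R : ℝ) * |(n j : ℝ)| / (2 * (L : ℝ) + 1)) ^ 2) :
    c ≤ (Real.sqrt (1728 * E) / (R : ℝ) ^ 4) ^ 2 := by
  have hN : (0 : ℝ) < 2 * (L : ℝ) + 1 := by positivity
  have hR0 : (0 : ℝ) < R := by exact_mod_cast hR
  have hRN : (R : ℝ) ≤ 2 * (L : ℝ) + 1 := by
    have : (R : ℝ) ≤ L := by exact_mod_cast hRL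
    linarith
  have habs : ∀ x ∈ Fintype.piFinset (fun _ : Fin 3 => Icc (-(L : ℤ)) (L : ℤ)), ∀ j, |x j| ≤ (L : ℤ) := by
    intro x hx j
    have h := Fintype.mem_piFinset.1 hx j
    rw [Finset.mem_Icc] at h
    exact abs_le.2 h
  -- Plancherel / orthogonality of the torus characters on the box
  have horth : ∀ x ∈ Fintype.piFinset (fun _ : Fin 3 => Icc (-(L : ℤ)) (L : ℤ)),
      ∀ x' ∈ Fintype.piFinset (fun _ : Fin 3 => Icc (-(L : ℤ)) (L : ℤ)),
        ∑ n ∈ Fintype.piFinset (fun _ : Fin 3 => Icc (-(L : ℤ)) (L : ℤ)),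
            Real.cos (2 * Real.pi * (∑ j, (n j : ℝ) * ((x - x') j : ℝ)) / (2 * (L : ℝ) + 1)) =
          if x = x' then (2 * (L : ℝ) + 1) ^ 3 else 0 := by
    intro x hx x' hx'
    rw [sum_box_cos_eq L (x - x')]
    have hiff : (∀ j, (2 * (L : ℤ) + 1) ∣ (x - x') j) ↔ x = x' := by
      rw [funext_iff]
      exact forall_congr' fun j => int_dvd_sub_iff_of_abs_le (habs x hx j) (habs x' hx' j)
    by_cases hxx : x = x'
    · rw [if_pos hxx, if_pos (hiff.2 hxx)]
    · rw [if_neg hxx, if_neg (fun h' => hxx (hiff.1 h'))]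
  -- the summed left-hand side collapses to the diagonal
  have hLHS : ∑ n ∈ Fintype.piFinset (fun _ : Fin 3 => Icc (-(L : ℤ)) (L : ℤ)),
      (R : ℝ) ^ 2 * ∑ x ∈ Fintype.piFinset (fun _ : Fin 3 => Icc (-(L : ℤ)) (L : ℤ)),
        ∑ x' ∈ Fintype.piFinset (fun _ : Fin 3 => Icc (-(L : ℤ)) (L : ℤ)),
          b (WithLp.toLp 2 fun j => (x j : ℝ) / (R : ℝ)) * b (WithLp.toLp 2 fun j => (x' j : ℝ) / (R : ℝ)) *
            Real.cos (2 * Real.pi * (∑ j, (n j : ℝ) * ((x - x') j : ℝ)) / (2 * (L : ℝ) + 1)) * cov x x' =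
      (R : ℝ) ^ 2 * ((2 * (L : ℝ) + 1) ^ 3 * (c * ∑ x ∈ Fintype.piFinset (fun _ : Fin 3 => Icc (-(L : ℤ)) (L : ℤ)),
        b (WithLp.toLp 2 fun j => (x j : ℝ) / (R : ℝ)) ^ 2)) := by
    rw [← Finset.mul_sum, Finset.sum_comm]
    congr 1
    rw [Finset.mul_sum, Finset.mul_sum]
    refine Finset.sum_congr rfl fun x hx => ?_
    rw [Finset.sum_comm]
    calc ∑ x' ∈ Fintype.piFinset (fun _ : Fin 3 => Icc (-(L : ℤ)) (L : ℤ)),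
          ∑ n ∈ Fintype.piFinset (fun _ : Fin 3 => Icc (-(L : ℤ)) (L : ℤ)),
            b (WithLp.toLp 2 fun j => (x j : ℝ) / (R : ℝ)) * b (WithLp.toLp 2 fun j => (x' j : ℝ) / (R : ℝ)) *
              Real.cos (2 * Real.pi * (∑ j, (n j : ℝ) * ((x - x') j : ℝ)) / (2 * (L : ℝ) + 1)) * cov x x'
        = ∑ x' ∈ Fintype.piFinset (fun _ : Fin 3 => Icc (-(L : ℤ)) (L : ℤ)),
            (b (WithLp.toLp 2 fun j => (x j : ℝ) / (R : ℝ)) * b (WithLp.toLp 2 fun j => (x' j : ℝ) / (R : ℝ)) *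
              cov x x') * (if x = x' then (2 * (L : ℝ) + 1) ^ 3 else 0) := by
          refine Finset.sum_congr rfl fun x' hx' => ?_
          rw [← horth x hx x' hx', Finset.mul_sum]
          exact Finset.sum_congr rfl fun n _ => by ring
      _ = (b (WithLp.toLp 2 fun j => (x j : ℝ) / (R : ℝ)) * b (WithLp.toLp 2 fun j => (x j : ℝ) / (R : ℝ)) *
              cov x x) * (2 * (L : ℝ) + 1) ^ 3 := by
          simp_rw [mul_ite, mul_zero]
          rw [Finset.sum_ite_eq, if_pos hx]
      _ = (2 * (L : ℝ) + 1) ^ 3 * (c * b (WithLp.toLp 2 fun j => (x j : ℝ) / (R : ℝ)) ^ 2) := by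
          rw [hdiag x hx]; ring
  -- the summed right-hand side is a product of three one-dimensional sums
  have hRHS : ∑ n ∈ Fintype.piFinset (fun _ : Fin 3 => Icc (-(L : ℤ)) (L : ℤ)),
      E / ∏ j, (1 + (R : ℝ) * |(n j : ℝ)| / (2 * (L : ℝ) + 1)) ^ 2 ≤
        E * (3 * (2 * (L : ℝ) + 1) / (R : ℝ)) ^ 3 := by
    have hfac : ∀ n ∈ Fintype.piFinset (fun _ : Fin 3 => Icc (-(L : ℤ)) (L : ℤ)),
        E / ∏ j, (1 + (R : ℝ) * |(n j : ℝ)| / (2 * (L : ℝ) + 1)) ^ 2 =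
          E * ∏ j, ((1 + (R : ℝ) / (2 * (L : ℝ) + 1) * |((n j : ℤ) : ℝ)|) ^ 2)⁻¹ := by
      intro n _
      rw [div_eq_mul_inv, ← Finset.prod_inv_distrib]
      congr 1
      refine Finset.prod_congr rfl fun j _ => ?_
      congr 2
      ring
    rw [Finset.sum_congr rfl hfac, ← Finset.mul_sum]
    refine mul_le_mul_of_nonneg_left ?_ hE
    rw [Finset.sum_prod_piFinset _ (fun _ (k : ℤ) => ((1 + (R : ℝ) / (2 * (L : ℝ) + 1) * |(k : ℝ)|) ^ 2)⁻¹)]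
    have ha : (0 : ℝ) < (R : ℝ) / (2 * (L : ℝ) + 1) := by positivity
    calc ∏ _j : Fin 3, ∑ k ∈ Icc (-(L : ℤ)) (L : ℤ), ((1 + (R : ℝ) / (2 * (L : ℝ) + 1) * |(k : ℝ)|) ^ 2)⁻¹
        ≤ ∏ _j : Fin 3, (1 + 2 / ((R : ℝ) / (2 * (L : ℝ) + 1))) :=
          Finset.prod_le_prod (fun _ _ => Finset.sum_nonneg fun k _ => by positivity)
            fun _ _ => sum_Icc_inv_one_add_mul_abs_sq_le L ha
      _ = (1 + 2 * (2 * (L : ℝ) + 1) / (R : ℝ)) ^ 3 := by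
          rw [Finset.prod_const, Finset.card_univ, Fintype.card_fin]
          congr 1
          field_simp
      _ ≤ (3 * (2 * (L : ℝ) + 1) / (R : ℝ)) ^ 3 := by
          have h1 : (1 : ℝ) ≤ (2 * (L : ℝ) + 1) / (R : ℝ) := by
            rw [le_div_iff₀ hR0]
            linarith
          gcongr ?_ ^ 3
          calc 1 + 2 * (2 * (L : ℝ) + 1) / (R : ℝ)
              ≤ (2 * (L : ℝ) + 1) / (R : ℝ) + 2 * (2 * (L : ℝ) + 1) / (R : ℝ) := by linarith
            _ = 3 * (2 * (L : ℝ) + 1) / (R : ℝ) := by ring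
  -- the packet mass from below
  have hmass := sum_box_sq_ge L R hR hRL b hb1
  have hsum := (Finset.sum_le_sum hS).trans hRHS
  rw [hLHS] at hsum
  -- conclude
  rw [div_pow, Real.sq_sqrt (by positivity), ← pow_mul, show 4 * 2 = 8 by norm_num, le_div_iff₀ (by positivity)]
  rcases le_or_gt c 0 with hc | hc
  · have : c * (R : ℝ) ^ 8 ≤ 0 := mul_nonpos_of_nonpos_of_nonneg hc (by positivity)
    nlinarith
  · have h1 : (R : ℝ) ^ 2 * ((2 * (L : ℝ) + 1) ^ 3 * (c * ((R : ℝ) / 4) ^ 3)) ≤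
        E * (3 * (2 * (L : ℝ) + 1) / (R : ℝ)) ^ 3 := by
      refine le_trans ?_ hsum
      have : c * ((R : ℝ) / 4) ^ 3 ≤ c * ∑ x ∈ Fintype.piFinset (fun _ : Fin 3 => Icc (-(L : ℤ)) (L : ℤ)),
          b (WithLp.toLp 2 fun j => (x j : ℝ) / (R : ℝ)) ^ 2 := mul_le_mul_of_nonneg_left hmass hc.le
      gcongr
    have e1 : 64 * (R : ℝ) ^ 3 * ((R : ℝ) ^ 2 * ((2 * (L : ℝ) + 1) ^ 3 * (c * ((R : ℝ) / 4) ^ 3))) =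
        c * (R : ℝ) ^ 8 * (2 * (L : ℝ) + 1) ^ 3 := by ring
    have e2 : 64 * (R : ℝ) ^ 3 * (E * (3 * (2 * (L : ℝ) + 1) / (R : ℝ)) ^ 3) =
        1728 * E * (2 * (L : ℝ) + 1) ^ 3 := by
      field_simp
      ring
    have h2 := mul_le_mul_of_nonneg_left h1 (by positivity : (0 : ℝ) ≤ 64 * (R : ℝ) ^ 3)
    rw [e1, e2] at h2
    exact le_of_mul_le_mul_right h2 (by positivity)

set_option maxHeartbeats 800000 in
/-- **Registered stub `stub_plancherelCovering`** (crux stmt-QuantumFields-23686 `CarrierSlackLargeMirrorCeiling`,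
LINE 1 «PlancherelCovering», planner ym-idea-11 g12), BY NAME AND SIGNATURE: the wave-packet RP square bound
`CarrierWavePacketBound` implies the σ = 0 point ceiling `CarrierPointCeiling` with `C = √(1728·E)` (same `ℓ₄`,
`β₄`, `L₀`), by the Plancherel covering inequality `point_le_of_wavePacket_bound` applied with `R := M`, the
transverse bump of `exists_transverse_bump`, and translation invariance of the torus two-point function
(`MirrorDomination.cov_translate`: `Cov_L(P_q(t₀,x), P_q(−t₀−δ,x)) = Cov_L(P_q(2t₀+δ,0), P_q(0))`). [folklore] -/
theorem stub_plancherelCovering : __Registered.stub_plancherelCovering := by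
  intro hA G _ _ _ _ hG hSU
  letI : MeasurableSpace G := borel G
  haveI : BorelSpace G := ⟨rfl⟩
  intro r v f g h Λ₅
  obtain ⟨ε₀, hε₀, hA'⟩ := hA G hG hSU r v f g h Λ₅
  refine ⟨ε₀, hε₀, fun ε hε hεε hfl => ?_⟩
  obtain ⟨b, hb_cpt, hb_supp, _hb0, _hb1, hbhalf⟩ := exists_transverse_bump
  obtain ⟨E, ℓ₄, β₄, hE, hℓ₄, hβ⟩ := hA' ε hε hεε hfl b hb_cpt hb_supp
  refine ⟨Real.sqrt (1728 * E), ℓ₄, β₄, hℓ₄, Real.sqrt_nonneg _, fun β hββ => ?_⟩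
  obtain ⟨L₀, hL₀⟩ := hβ β hββ
  refine ⟨L₀, fun s hs hs1 hsel hfl' L q R t₀ hq hR hRs hRt ht2 hRL hL0 => ?_⟩
  dsimp only
  have hRL' : R ≤ L := by omega
  have habs : ∀ n ∈ Fintype.piFinset (fun _ : Fin 3 => Icc (-(L : ℤ)) (L : ℤ)), ∀ j, |n j| ≤ (L : ℤ) := by
    intro n hn j
    have h := Fintype.mem_piFinset.1 hn j
    rw [Finset.mem_Icc] at h
    exact abs_le.2 h
  refine point_le_of_wavePacket_bound L R hR hRL' b hbhalf _ _ E hE ?_ fun n hn => by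
    have key := hL₀ s hs hs1 hsel hfl' L q R t₀ n hq hR hRs hRt ht2 hRL hL0 (habs n hn)
    dsimp only at key
    exact key
  -- constant diagonal: translation invariance of the torus two-point function
  intro x _
  have key := Summit.QuantumFields.YangMills.Theorems.MirrorDomination.cov_translate G r β L q q
    (fun i : Fin 4 => if i = 0 then (2 * (t₀ : ℤ) + (if q.1 = 0 then 1 else 0)) else 0) (fun _ => 0)
    (Fin.cons (-(t₀ : ℤ) - (if q.1 = 0 then 1 else 0)) x)
  have h1 : ((fun i : Fin 4 => if i = 0 then (2 * (t₀ : ℤ) + (if q.1 = 0 then 1 else 0)) else 0) +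
      Fin.cons (-(t₀ : ℤ) - (if q.1 = 0 then 1 else 0)) x : Fin 4 → ℤ) = Fin.cons (t₀ : ℤ) x := by
    funext i
    refine Fin.cases ?_ (fun j => ?_) i
    · simp only [Pi.add_apply, Fin.cons_zero, if_true]
      ring
    · simp [Fin.succ_ne_zero]
  have h2 : ((fun _ : Fin 4 => (0 : ℤ)) + Fin.cons (-(t₀ : ℤ) - (if q.1 = 0 then 1 else 0)) x : Fin 4 → ℤ) =
      Fin.cons (-(t₀ : ℤ) - (if q.1 = 0 then 1 else 0)) x := by
    funext i
    simp
  rw [h1, h2] at key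
  exact key

end Summit.QuantumFields.YangMills.Theorems.SlackWindowPlancherelCovering
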